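import Literature.Topology.FourManifolds.PuncturedTubeMiddleHomology
import Literature.Topology.FourManifolds.SphereSurgeryStep
import HarnessLib

/-!
# Surgery in the middle dimension of an odd-dimensional manifold: Kervaire–Milnor's Lemma 5.6
# (`HₖM/λ(Z) ≅ HₖM'/λ'(Z)`) and its primitive case (`HₖM' ≅ HₖM/λ(Z)`)

Topic `Literature/Topology/FourManifolds`; sequel of `SphereSurgeryHomology.lean` (surgery BELOW
the middle dimension, Kosinski X.1.1) and `SphereSurgeryHandleMeridian.lean` (the torus
`Sᵏ × Sˡ` of a surgery, `k ≠ l`), written for the fact seat of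
`Literature.Topology.FourManifolds.HomotopySphere.boundsContractible_of_nullCobordism_isStablyParallelizable_four`
(M. Kervaire, J. Milnor, *Groups of homotopy spheres I*, Ann. of Math. 77 (1963), **Thm. 5.1**
at `k = 2`), whose reduction along the printed proof
(`HomotopySphere.boundsContractible_of_nullCobordism_isStablyParallelizable_four_of_surgeryLemmas`,
`ThetaFourKervaireMilnorSurgeryProofs.lean`) takes **Lemma 5.6** (hypothesis `h56`) and the
**Assertion** of p. 516 (hypothesis `hkill`) as inputs. Everything here is **proved**; no
definition and no named fact is introduced (D-0026).

Kervaire–Milnor, Lemma 5.6 (p. 514–515): *"Let `M'= χ(M, φ)` where `φ` imbeds `Sᵏ × Dᵏ⁺¹` in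
`M` [`M` of dimension `2k + 1`], `λ ∈ HₖM` the class of `φ(Sᵏ × 0)` and `λ' ∈ HₖM'` the class of
`φ'(0 × Sᵏ)`. … It follows that the quotient group `HₖM/λ(Z)` is isomorphic to `HₖM'/λ'(Z)`."*
The printed proof reads both groups off `M₀ = M ∖ Interior φ(Sᵏ × Dᵏ⁺¹)`:
`HₖM ≅ HₖM₀/ε'(Z)` and `HₖM' ≅ HₖM₀/ε(Z)`, where `ε`, `ε'` are the classes of the "parallel"
`φ(Sᵏ × x₀)` and the "meridian" `φ(x₀ × Sᵏ)` of the torus `φ(Sᵏ × Sᵏ)` (p. 515–516), and `ε ↦ λ`,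
`ε' ↦ λ'`.  Here this is organised, exactly as in the two companion files, through the
Mayer–Vietoris sequences of `X = (X ∖ S) ∪ φ(Sᵏ × Bᵏ⁺¹)` and of the surgered space
`P = jA(X ∖ S) ∪ jB(ODᵏ⁺¹ × Sᵏ)` (Hatcher 2002, §2.2), whose common intersection is the punctured
tube `Sᵏ × (Bᵏ⁺¹ ∖ 0) ≃ Sᵏ × Sᵏ` with `Hₖ ≅ ℤ²` on the meridian and the parallel
(`PuncturedTubeMiddleHomology.lean`), with `G = Hₖ(X ∖ S)` in the rôle of `HₖM₀`:

* `nonempty_addEquiv_quotientPair`, `nonempty_addEquiv_quotient_of_ker_eq` — the algebra: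
  `f : G ↠ H` with `f b = 0` and `ker f ⊆ ⟨a, b⟩` gives `G/⟨a, b⟩ ≃+ H/⟨f a⟩`; with
  `ker f = ⟨a⟩` and `e : G ≅ H'`, `H ≃+ H'/⟨e a⟩`;
* (from `PuncturedTubeMiddleHomology.lean`, the tree's first brick towards Lemma 5.6:
  `FramedSphereFamily.exists_eq_zsmul_meridianPT_add_zsmul_parallelPT` — every class of
  `Hₖ(Sᵏ × (Bᵏ⁺¹ ∖ 0))` is `m ε' + n ε` on the meridian and the parallel; its sequel
  `SphereCoreMeridian.lean` proves the exact kernel `ker (Hₖ(X ∖ S) → Hₖ(X)) = ε'(Z)`, of which only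
  the inclusion in `⟨ε, ε'⟩` is used — and reproved — here);
* `FramedSphereFamily.map_val_tubeIncl_meridianPT_eq_zero` — the meridian sphere
  `v ↦ φ(u₀, v/2)` of `X ∖ S` bounds a normal disc, so dies in `X`;
  `epi_map_complement_val_of_lt` — `Hₙ(X ∖ S) → Hₙ(X)` is onto for `n < l + 1`
  (`SphereCoreLocalHomology`); `mem_closure_pair_of_map_complement_val_eq_zero` —
  `ker (Hₖ(X ∖ S) → Hₖ(X)) ⊆ ⟨ε, ε'⟩` (Mayer–Vietoris for `X = (X ∖ S) ∪ φ(Sᵏ × Bᵏ⁺¹)`,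
  `complement_inter_image_unitTube`, `map_tubeIncl_mem_closure_pair`);
* `FramedSphereFamily.compl_image_coreSlice_eq_range_jA` — `jA(X ∖ S) = P ∖ S'` for the
  core `S' = jB(0 × Sˡ)` of the handle (`jB_mem_range_jA`, `jB_coreSlice_not_mem_range_jA`);
  `epi_map_jA_of_lt` — `(jA)_* : Hₙ(X ∖ S) → Hₙ(P)` is onto for `n < k + 1`;
  `map_jB_coreSlice_eq_map_jA_meridian` — in `P` the new core is homotopic to the meridian;
  `mem_closure_pair_of_map_jA_eq_zero` — `ker (Hₖ(X ∖ S) → Hₖ(P)) ⊆ ⟨ε, ε'⟩` (Mayer–Vietoris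
  for `P`, `tubeInterHomeomorph`);
* `FramedSphereFamily.nonempty_quotient_addEquiv_quotient_of_surgery` — **Lemma 5.6**:
  `Hₖ(X)/λ(Z) ≃+ Hₖ(P)/λ'(Z)` with `λ = φ(·, 0)_* θ`, `λ' = (jB(0, ·))_* θ`, `θ` a generator of
  `Hₖ(Sᵏ; ℤ)`, `k ≥ 2`;
* `FramedSphereFamily.nonempty_addEquiv_quotient_of_surgery_of_epi` — **the Assertion of p. 516
  in homological form**: if moreover `Hₖ₊₁(X) → Hₖ₊₁(X, X ∖ S)` is onto (the primitivity
  `μ·λ = 1`, exactly the hypothesis `hprim` of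
  `FramedSphereFamily.isZero_singularHomology_of_middleSurgery_of_epi`), then `Hₖ(X ∖ S) → Hₖ(X)`
  is also into, the meridian class vanishes in `Hₖ(X ∖ S)`, and `Hₖ(P) ≃+ Hₖ(X)/λ(Z)` ("any
  primitive element can be killed");
* `FramedSphereFamily.nonempty_quotient_addEquiv_quotient_surgered`,
  `nonempty_addEquiv_quotient_surgered_of_epi` — the specialisations to the tree's surgered
  manifold `χ(X, φ) = ν.Surgered hkl` (`SphereFamilySurgeryExistence.lean`, `surgered_gluing`).

## References

* M. Kervaire, J. Milnor, *Groups of homotopy spheres I*, Ann. of Math. (2) 77 (1963), 504–537: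
  Lemma 5.6 and its proof (pp. 514–516), Assertion p. 516, Lemma 5.7 (p. 516).
  doi:10.2307/1970128 [KervaireMilnorAnnals1963]
* A. Hatcher, *Algebraic Topology*, CUP 2002, §2.2 pp. 149–150 (Mayer–Vietoris), Thm. 2.16
  (exact sequence of the pair), Thm. 3B.6 (`H⁎(Sᵏ × Sᵏ)`, here via `SphereProductSlicesMixed`).
  [HatcherAT2002]
* A. Kosinski, *Differential Manifolds* (1993), Ch. X §1, Prop. (1.1), (1.3). [Kosinski1993]
-/

noncomputable section

open scoped Manifold ContDiff Topology ContinuousMap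
open CategoryTheory Limits Set Function Metric Topology
open Literature.AlgebraicTopology.SingularHomology

universe u

namespace Literature.Topology.FourManifolds

/-! ### Algebra: quotients by a pair of classes -/

section Algebra

variable {G H : Type*} [AddCommGroup G] [AddCommGroup H]

/-- **The algebra of Lemma 5.6.** If `f : G → H` is onto, kills `b`, and its kernel lies in the
subgroup generated by `a` and `b`, then `f` induces `G/⟨a, b⟩ ≃+ H/⟨f a⟩` (Kervaire–Milnor 1963,
proof of Lemma 5.6: `HₖM ≅ HₖM₀/ε'(Z)` hence `HₖM/λ(Z) ≅ HₖM₀/(ε(Z) + ε'(Z))`).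
[cite: KervaireMilnorAnnals1963, Lemma 5.6, proof (pp. 515–516)] -/
theorem nonempty_addEquiv_quotientPair (f : G →+ H) (hf : Function.Surjective f) (a b : G)
    (hb : f b = 0) (hker : ∀ g, f g = 0 → g ∈ AddSubgroup.closure ({a, b} : Set G)) :
    Nonempty (G ⧸ AddSubgroup.closure ({a, b} : Set G) ≃+ H ⧸ AddSubgroup.zmultiples (f a)) := by
  have hle : AddSubgroup.closure ({a, b} : Set G) ≤
      (AddSubgroup.zmultiples (f a)).comap f := by
    rw [AddSubgroup.closure_le]
    rintro x (rfl | rfl)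
    · exact AddSubgroup.mem_zmultiples (f x)
    · show f x ∈ AddSubgroup.zmultiples (f a)
      rw [hb]
      exact zero_mem _
  let F := QuotientAddGroup.map (AddSubgroup.closure ({a, b} : Set G))
    (AddSubgroup.zmultiples (f a)) f hle
  refine ⟨AddEquiv.ofBijective F ⟨?_, ?_⟩⟩
  · rw [injective_iff_map_eq_zero]
    intro x hx
    induction x using QuotientAddGroup.induction_on with
    | H g =>
      rw [QuotientAddGroup.map_mk, QuotientAddGroup.eq_zero_iff, AddSubgroup.mem_zmultiples_iff]
        at hx
      obtain ⟨m, hm⟩ := hx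
      rw [QuotientAddGroup.eq_zero_iff]
      have h1 : g - m • a ∈ AddSubgroup.closure ({a, b} : Set G) :=
        hker _ (by rw [map_sub, map_zsmul, hm, sub_self])
      have h2 : m • a ∈ AddSubgroup.closure ({a, b} : Set G) :=
        AddSubgroup.zsmul_mem _ (AddSubgroup.subset_closure (by simp)) m
      simpa using AddSubgroup.add_mem _ h1 h2
  · intro y
    induction y using QuotientAddGroup.induction_on with
    | H h =>
      obtain ⟨g, rfl⟩ := hf h
      exact ⟨QuotientAddGroup.mk g, by rw [QuotientAddGroup.map_mk]⟩

/-- **The algebra of the Assertion of p. 516.** If `f : G → H` is onto with kernel exactly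
`⟨a⟩`, then `H ≃+ G/⟨a⟩`; combined with an isomorphism `e : G ≃+ H'` this reads
`H ≃+ H'/⟨e a⟩`. [cite: KervaireMilnorAnnals1963, Lemma 5.6, proof (p. 516)] -/
theorem nonempty_addEquiv_quotient_of_ker_eq {H' : Type*} [AddCommGroup H'] (f : G →+ H)
    (hf : Function.Surjective f) (a : G) (ha : f a = 0)
    (hker : ∀ g, f g = 0 → g ∈ AddSubgroup.zmultiples a) (e : G →+ H')
    (he : Function.Bijective e) :
    Nonempty (H ≃+ H' ⧸ AddSubgroup.zmultiples (e a)) := by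
  -- `G/⟨a⟩ ≃+ H` by `f`
  have hkerf : f.ker = AddSubgroup.zmultiples a := by
    ext g
    rw [AddMonoidHom.mem_ker]
    refine ⟨hker g, fun hg => ?_⟩
    obtain ⟨m, rfl⟩ := AddSubgroup.mem_zmultiples_iff.1 hg
    rw [map_zsmul, ha, zsmul_zero]
  let e₁ : G ⧸ AddSubgroup.zmultiples a ≃+ H :=
    QuotientAddGroup.quotientAddEquivOfEq hkerf.symm |>.trans
      (QuotientAddGroup.quotientKerEquivOfSurjective f hf)
  -- `G/⟨a⟩ ≃+ H'/⟨e a⟩` by `e`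
  let E : G ≃+ H' := AddEquiv.ofBijective e he
  have hmap : (AddSubgroup.zmultiples a).map (E : G →+ H') = AddSubgroup.zmultiples (e a) := by
    rw [AddMonoidHom.map_zmultiples]
    rfl
  let e₂ : G ⧸ AddSubgroup.zmultiples a ≃+ H' ⧸ AddSubgroup.zmultiples (e a) :=
    (QuotientAddGroup.congr (AddSubgroup.zmultiples a) _ E rfl).trans
      (QuotientAddGroup.quotientAddEquivOfEq hmap)
  exact ⟨e₁.symm.trans e₂⟩

end Algebra

namespace FramedSphereFamily

/-! ### The tube side: `Hₖ(X ∖ S) → Hₖ(X)` is onto with kernel inside `⟨parallel, meridian⟩` -/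

section TubeSide

variable {EX HX : Type*} [NormedAddCommGroup EX] [NormedSpace ℝ EX] [TopologicalSpace HX]
  {IX : ModelWithCorners ℝ EX HX} {X : Type} [TopologicalSpace X] [ChartedSpace HX X] [T2Space X]
  {ι : Type} [Unique ι] {k l : ℕ} (ν : FramedSphereFamily IX X ι k (l + 1))

/-- The parallel of the punctured tube, pushed into `X ∖ S`, is the parallel sphere of
`SphereSurgeryHomology.lean` (a private copy, for general fibre dimension, of the tree's
`FramedSphereFamily.tubeIncl_comp_parallelPT` of `SphereCoreMeridian.lean`). [folklore] -/
private theorem tubeIncl_comp_parallelPT' {v₀ : EuclideanSpace ℝ (Fin (l + 1))} (hv₀ : v₀ ≠ 0)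
    (hv₁ : ‖v₀‖ < 1) : ν.tubeIncl.comp (parallelPT hv₀ hv₁) = ν.parallelSphere hv₀ := by
  ext u; rfl

/-- **In `X` the meridian sphere `v ↦ φ(u₀, v/2)` (the map `tubeIncl ∘ meridianPT u₀ : Sˡ → X ∖ S`;
Kervaire–Milnor 1963, p. 516: the meridian `φ(x₀ × Sˡ)` of the torus, whose class is `ε'`) bounds
a disc** (the normal disc `w ↦ φ(u₀, w)`, `‖w‖ ≤ ½`), so it induces `0` on `Hₙ(X)`, `n ≠ 0`
(p. 515: the composite `Z →ε' HₖM₀ → HₖM` of the vertical exact sequence vanishes).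
[cite: KervaireMilnorAnnals1963, Lemma 5.6, proof (pp. 515–516)] -/
theorem map_val_tubeIncl_meridianPT_eq_zero (u₀ : (Metric.sphere (0 : EuclideanSpace ℝ (Fin (k + 1))) 1)) {n : ℕ} (hn : n ≠ 0) :
    singularHomology.map ℤ ℤ ((subsetIncl (ν.complement : Set X)).comp
      (ν.tubeIncl.comp (meridianPT u₀))) n = 0 := by
  refine map_eq_zero_of_homotopic_const ℤ ℤ _ (ν.toFun default (u₀, 0)) ⟨?_⟩ hn
  exact
    { toFun := fun p => ν.toFun default (u₀, ((1 - (p.1 : ℝ)) * 2⁻¹) • (p.2 : EuclideanSpace ℝ (Fin (l + 1))))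
      continuous_toFun := (ν.continuous default).comp (continuous_const.prodMk
        (((continuous_const.sub (continuous_subtype_val.comp continuous_fst)).mul
          continuous_const).smul (continuous_subtype_val.comp continuous_snd)))
      map_zero_left := fun v => by
        show ν.toFun default (u₀, ((1 - (0 : ℝ)) * 2⁻¹) • (v : EuclideanSpace ℝ (Fin (l + 1)))) =
          ν.toFun default (u₀, (2⁻¹ : ℝ) • (v : EuclideanSpace ℝ (Fin (l + 1))))
        norm_num
      map_one_left := fun v => by
        show ν.toFun default (u₀, ((1 - (1 : ℝ)) * 2⁻¹) • (v : EuclideanSpace ℝ (Fin (l + 1)))) =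
          ν.toFun default (u₀, 0)
        simp }

/-- **`Hₙ(X ∖ S) → Hₙ(X)` is onto for `n < l + 1`** (the codimension of the core; exact sequence
of the pair and `Hₙ(X | S) = 0`, `SphereCoreLocalHomology`). In the middle dimension of an odd
manifold (`n = k = l`) this is Kervaire–Milnor's "`HₖM₀ → HₖM → 0`" (diagram p. 515).
[cite: KervaireMilnorAnnals1963, Lemma 5.6, proof (p. 515)] [cite: Kosinski1993, Ch. X §1, Prop. 1.1] -/
theorem epi_map_complement_val_of_lt {n : ℕ} (hn : n < l + 1) :
    Epi (singularHomology.map ℤ ℤ (subsetIncl (ν.complement : Set X)) n) := by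
  have h := epi_map_subsetIncl_compl_sphereCore ℤ ℤ (ν.isOpenEmbedding_toFun default) (i := n)
    (c := l + 1) hn
  rw [← coe_complement_eq] at h
  exact h

omit [T2Space X] in
/-- The open unit tube `φ(Sᵏ × Bˡ⁺¹)` of the (unique) sphere of the family is open. [folklore] -/
theorem isOpen_image_unitTube : IsOpen (ν.toFun default '' {q | ‖q.2‖ < 1}) :=
  (ν.isOpenEmbedding_toFun default).isOpenMap _
    (isOpen_lt (continuous_norm.comp continuous_snd) continuous_const)

/-- `X = (X ∖ S) ∪ φ(Sᵏ × Bˡ⁺¹)`. [folklore] -/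
theorem complement_union_image_unitTube :
    (ν.complement : Set X) ∪ ν.toFun default '' {q | ‖q.2‖ < 1} = univ := by
  refine eq_univ_of_forall fun x => ?_
  by_cases hx : x ∈ ν.cores
  · obtain ⟨i, v, rfl⟩ := ν.mem_cores_iff.1 hx
    rw [Subsingleton.elim i default]
    exact Or.inr ⟨(v, 0), by simp, rfl⟩
  · exact Or.inl hx

/-- `(X ∖ S) ∩ φ(Sᵏ × Bˡ⁺¹)` is the punctured unit tube `φ(Sᵏ × (Bˡ⁺¹ ∖ 0))`. [folklore] -/
theorem complement_inter_image_unitTube :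
    (ν.complement : Set X) ∩ ν.toFun default '' {q | ‖q.2‖ < 1} =
      ν.toFun default '' puncturedUnitTube k l := by
  ext x
  constructor
  · rintro ⟨hxc, ⟨⟨u, w⟩, hw, rfl⟩⟩
    refine ⟨(u, w), ⟨fun h0 => hxc ?_, hw⟩, rfl⟩
    simp only at h0
    subst h0
    exact ν.sphere_mem_cores default u
  · rintro ⟨q, hq, rfl⟩
    exact ⟨ν.apply_mem_complement default q.1 hq.1, ⟨q, hq.2, rfl⟩⟩

end TubeSide

section TubeSideMiddle

variable {EX HX : Type*} [NormedAddCommGroup EX] [NormedSpace ℝ EX] [TopologicalSpace HX]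
  {IX : ModelWithCorners ℝ EX HX} {X : Type} [TopologicalSpace X] [ChartedSpace HX X] [T2Space X]
  {ι : Type} [Unique ι] {k : ℕ} (ν : FramedSphereFamily IX X ι k (k + 1))

/-- **Every class of `Hₖ` of the punctured tube maps into `⟨ε, ε'⟩ ⊆ Hₖ(X ∖ S)`**, the subgroup
generated by the classes `ε` of the parallel sphere and `ε'` of the meridian sphere (`k ≥ 2`,
fibre `ℝᵏ⁺¹`: the middle dimension of an odd-dimensional manifold).
[cite: KervaireMilnorAnnals1963, Lemma 5.6, proof (p. 515)] -/
theorem map_tubeIncl_mem_closure_pair (hk : 2 ≤ k) (u₀ : (Metric.sphere (0 : EuclideanSpace ℝ (Fin (k + 1))) 1)) {v₀ : EuclideanSpace ℝ (Fin (k + 1))} (hv₀ : v₀ ≠ 0)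
    (hv₁ : ‖v₀‖ < 1) {θ : singularHomology ℤ ℤ ((Metric.sphere (0 : EuclideanSpace ℝ (Fin (k + 1))) 1)) k} (hθ : AddSubgroup.zmultiples θ = ⊤)
    (z : singularHomology ℤ ℤ ↥(puncturedUnitTube k k) k) :
    singularHomology.map ℤ ℤ ν.tubeIncl k z ∈ AddSubgroup.closure
      ({singularHomology.map ℤ ℤ (ν.parallelSphere hv₀) k θ,
        singularHomology.map ℤ ℤ (ν.tubeIncl.comp (meridianPT u₀)) k θ} : Set (singularHomology ℤ ℤ ↥ν.complement k)) := by
  obtain ⟨m, n, rfl⟩ := exists_eq_zsmul_meridianPT_add_zsmul_parallelPT hk hθ u₀ hv₀ hv₁ z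
  rw [map_add, map_zsmul, map_zsmul, ← ModuleCat.comp_apply, ← singularHomology.map_comp,
    ← ModuleCat.comp_apply, ← singularHomology.map_comp, tubeIncl_comp_parallelPT']
  refine AddSubgroup.add_mem _ (AddSubgroup.zsmul_mem _ (AddSubgroup.subset_closure ?_) _)
    (AddSubgroup.zsmul_mem _ (AddSubgroup.subset_closure ?_) _)
  · exact Or.inr rfl
  · exact Or.inl rfl

/-- **`ker (Hₖ(X ∖ S) → Hₖ(X)) ⊆ ⟨ε, ε'⟩`** (`k ≥ 2`, fibre `ℝᵏ⁺¹`): by exactness of the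
Mayer–Vietoris sequence of `X = (X ∖ S) ∪ φ(Sᵏ × Bᵏ⁺¹)` at `Hₖ(X ∖ S) ⊕ Hₖ(tube)`, a class dying in
`X` comes from the intersection, the punctured tube (Kervaire–Milnor 1963, p. 515: the kernel of
`HₖM₀ → HₖM` is `ε'(Z)`; here only the inclusion in `⟨ε, ε'⟩` is recorded, which is what Lemma 5.6
uses). [cite: KervaireMilnorAnnals1963, Lemma 5.6, proof (p. 515)] [cite: HatcherAT2002, §2.2 p. 149] -/
theorem mem_closure_pair_of_map_complement_val_eq_zero (hk : 2 ≤ k) (u₀ : (Metric.sphere (0 : EuclideanSpace ℝ (Fin (k + 1))) 1)) {v₀ : EuclideanSpace ℝ (Fin (k + 1))}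
    (hv₀ : v₀ ≠ 0) (hv₁ : ‖v₀‖ < 1) {θ : singularHomology ℤ ℤ ((Metric.sphere (0 : EuclideanSpace ℝ (Fin (k + 1))) 1)) k}
    (hθ : AddSubgroup.zmultiples θ = ⊤) (g : singularHomology ℤ ℤ ↥ν.complement k)
    (hg : singularHomology.map ℤ ℤ (subsetIncl (ν.complement : Set X)) k g = 0) :
    g ∈ AddSubgroup.closure
      ({singularHomology.map ℤ ℤ (ν.parallelSphere hv₀) k θ,
        singularHomology.map ℤ ℤ (ν.tubeIncl.comp (meridianPT u₀)) k θ} : Set (singularHomology ℤ ℤ ↥ν.complement k)) := by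
  -- Mayer–Vietoris for `X = U ∪ V`, `U = X ∖ S`, `V` the open unit tube
  set U : Set X := (ν.complement : Set X) with hU
  set V : Set X := ν.toFun default '' {q | ‖q.2‖ < 1} with hV
  have hUo : IsOpen U := ν.complement.isOpen
  have hint : interior U ∪ interior V = univ := by
    rw [hUo.interior_eq, ν.isOpen_image_unitTube.interior_eq]
    exact ν.complement_union_image_unitTube
  have hex := mayerVietoris.exact₁_holds ℤ ℤ U V hint k
  rw [ShortComplex.moduleCat_exact_iff] at hex
  let HU := singularHomology ℤ ℤ ↥U k
  let HV := singularHomology ℤ ℤ ↥V k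
  obtain ⟨zUV, hz⟩ := hex ((biprod.inl : HU ⟶ HU ⊞ HV) g) (by
    show (mayerVietoris.ψ ℤ ℤ U V k) ((biprod.inl : HU ⟶ HU ⊞ HV) g) = 0
    rw [mayerVietoris.ψ, biprod_desc_inl_apply]
    exact hg)
  -- so `g` is the image of a class of the punctured tube
  have hg' : g = singularHomology.map ℤ ℤ
      (subsetInclusion (inter_subset_left : U ∩ V ⊆ U)) k zUV := by
    have h1 := congrArg (biprod.fst : HU ⊞ HV ⟶ HU) hz
    change (biprod.fst : HU ⊞ HV ⟶ HU) ((mayerVietoris.φ ℤ ℤ U V k) zUV) =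
      (biprod.fst : HU ⊞ HV ⟶ HU) ((biprod.inl : HU ⟶ HU ⊞ HV) g) at h1
    rw [mayerVietoris.φ, biprod_fst_lift_apply, ← ModuleCat.comp_apply, biprod.inl_fst,
      ModuleCat.id_apply] at h1
    exact h1.symm
  -- the intersection is the punctured tube, included by `tubeIncl`
  let eT : ↥(puncturedUnitTube k k) ≃ₜ ↥(U ∩ V) :=
    ((ν.isOpenEmbedding_toFun default).isEmbedding.homeomorphImage (puncturedUnitTube k k)).trans
      (Homeomorph.setCongr ν.complement_inter_image_unitTube.symm)
  have heT : (subsetInclusion (inter_subset_left : U ∩ V ⊆ U)).comp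
      (eT : C(↥(puncturedUnitTube k k), ↥(U ∩ V))) = ν.tubeIncl := by
    ext q; rfl
  set z := singularHomology.map ℤ ℤ (eT.symm : C(↥(U ∩ V), ↥(puncturedUnitTube k k))) k zUV
    with hzdef
  have hzUV : zUV = singularHomology.map ℤ ℤ (eT : C(↥(puncturedUnitTube k k), ↥(U ∩ V))) k z := by
    rw [hzdef, ← ModuleCat.comp_apply, ← singularHomology.map_comp]
    have : (eT : C(↥(puncturedUnitTube k k), ↥(U ∩ V))).comp
        (eT.symm : C(↥(U ∩ V), ↥(puncturedUnitTube k k))) = ContinuousMap.id _ := by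
      ext1 x; exact eT.apply_symm_apply x
    rw [this, singularHomology.map_id]
    rfl
  rw [hg', hzUV, ← ModuleCat.comp_apply, ← singularHomology.map_comp, heT]
  exact ν.map_tubeIncl_mem_closure_pair hk u₀ hv₀ hv₁ hθ z

end TubeSideMiddle

/-! ### The handle side: `jA(X ∖ S) = P ∖ S'`, `Hₖ(X ∖ S) → Hₖ(P)` onto, kernel inside `⟨ε, ε'⟩` -/

section HandleSide

variable {EX HX : Type*} [NormedAddCommGroup EX] [NormedSpace ℝ EX] [TopologicalSpace HX]
  {IX : ModelWithCorners ℝ EX HX} {X : Type} [TopologicalSpace X] [ChartedSpace HX X] [T2Space X]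
  {ι : Type} [Unique ι] {k l : ℕ} (ν : FramedSphereFamily IX X ι k (l + 1))
  {P : Type} [TopologicalSpace P] {jA : ↥ν.complement → P} {jB : ↥(ballTimesSphere ι k l) → P}

variable {ν}
variable (hA : IsOpenEmbedding jA) (hB : IsOpenEmbedding jB) (hcov : range jA ∪ range jB = univ)
  (hrel : ∀ a b, jA a = jB b ↔ sphereFamilySurgeryRel ν a b)

omit [TopologicalSpace P] in
include hrel in
/-- **Off its core, the handle lies in `jA(X ∖ S)`**: a point `jB(y, u)` with `y ≠ 0` is
`jA(φ(y/‖y‖, ‖y‖u))` (Milnor's identification read backwards). [cite: MilnorHCobordism1965, Def. 3.11 (PDF p. 17)] -/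
theorem jB_mem_range_jA {b : ↥(ballTimesSphere ι k l)}
    (hb : (b : DiscreteIndex ι × ((EuclideanSpace ℝ (Fin (k + 1))) × ((Metric.sphere (0 : EuclideanSpace ℝ (Fin (l + 1))) 1)))).2.1 ≠ 0) : jB b ∈ range jA := by
  set y := (b : DiscreteIndex ι × ((EuclideanSpace ℝ (Fin (k + 1))) × ((Metric.sphere (0 : EuclideanSpace ℝ (Fin (l + 1))) 1)))).2.1 with hy
  set u := (b : DiscreteIndex ι × ((EuclideanSpace ℝ (Fin (k + 1))) × ((Metric.sphere (0 : EuclideanSpace ℝ (Fin (l + 1))) 1)))).2.2 with hu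
  have hy1 : ‖y‖ < 1 := b.2
  let q : ↥(puncturedUnitTube k l) := ⟨(radialProjection (spherePt k) y, ‖y‖ • (u : EuclideanSpace ℝ (Fin (l + 1)))),
    ⟨smul_ne_zero (norm_ne_zero_iff.2 hb) (ne_zero_of_mem_unit_sphere u),
      by rw [norm_smul_coe_sphere (norm_nonneg _)]; exact hy1⟩⟩
  have hq : glueMapPT ι k l q = b := by
    apply Subtype.ext
    show (DiscreteIndex.mk default, (‖‖y‖ • (u : EuclideanSpace ℝ (Fin (l + 1)))‖ • ((radialProjection (spherePt k) y :
        (Metric.sphere (0 : EuclideanSpace ℝ (Fin (k + 1))) 1)) : EuclideanSpace ℝ (Fin (k + 1))), radialProjection (spherePt l) (‖y‖ • (u : EuclideanSpace ℝ (Fin (l + 1)))))) = b.1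
    rw [norm_smul_coe_sphere (norm_nonneg _), norm_smul_coe_radialProjection,
      radialProjection_smul _ (norm_pos_iff.2 hb), ← DiscreteIndex.eq_mk_default b.1.1]
  exact ⟨ν.tubeIncl q, by rw [jA_tubeIncl hrel q, hq]⟩

omit [TopologicalSpace P] in
include hrel in
/-- **The core of the handle misses `jA(X ∖ S)`**: `jB(0, u) ≠ jA a` (Milnor's identification
only concerns `0 < θ`). [cite: MilnorHCobordism1965, Def. 3.11 (PDF p. 17)] -/
theorem jB_coreSlice_not_mem_range_jA (u : (Metric.sphere (0 : EuclideanSpace ℝ (Fin (l + 1))) 1)) : jB (coreSlice ι k l u) ∉ range jA := by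
  rintro ⟨a, ha⟩
  obtain ⟨v, θ, hθ, hyv, -⟩ := (hrel a _).1 ha
  have h0 : θ • (v : EuclideanSpace ℝ (Fin (k + 1))) = 0 := hyv.symm
  exact smul_ne_zero hθ.1.ne' (ne_zero_of_mem_unit_sphere v) h0

include hcov hrel in
omit [TopologicalSpace P] in
/-- **`jA(X ∖ S) = P ∖ S'`**: the complement of the new core sphere `S' = jB(0 × Sˡ)` in `P` is the
image of `X ∖ S` — "the two manifolds have the common piece `M ∖ S = χ ∖ S'`" (Kervaire–Milnor
1963, p. 513: `M' = M₀ ∪ Dᵏ⁺¹ × Sˡ` with `M₀ = M ∖ Interior φ(Sᵏ × Dˡ⁺¹)`).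
[cite: KervaireMilnorAnnals1963, §5 p. 513] -/
theorem compl_image_coreSlice_eq_range_jA : (jB '' range (coreSlice ι k l))ᶜ = range jA := by
  ext x
  rw [mem_compl_iff]
  constructor
  · intro hx
    rcases (show x ∈ range jA ∪ range jB by rw [hcov]; trivial) with h | ⟨b, rfl⟩
    · exact h
    · by_cases hb : (b : DiscreteIndex ι × ((EuclideanSpace ℝ (Fin (k + 1))) × ((Metric.sphere (0 : EuclideanSpace ℝ (Fin (l + 1))) 1)))).2.1 = 0
      · exact (hx ⟨coreSlice ι k l b.1.2.2, ⟨_, rfl⟩, congrArg jB (Subtype.ext (by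
          show (DiscreteIndex.mk default, ((0 : EuclideanSpace ℝ (Fin (k + 1))), b.1.2.2)) = b.1
          rw [← hb, ← DiscreteIndex.eq_mk_default b.1.1]))⟩).elim
      · exact jB_mem_range_jA hrel hb
  · rintro ⟨a, rfl⟩ ⟨_, ⟨u, rfl⟩, hu⟩
    exact jB_coreSlice_not_mem_range_jA hrel u ⟨a, hu.symm⟩

include hB hcov hrel in
/-- **`Hₙ(jA(X ∖ S)) → Hₙ(P)` is onto for `n < k + 1`** (`P` Hausdorff; `k + 1` is the
codimension of the new core `S'`; exact sequence of the pair `(P, P ∖ S')` and `Hₙ(P | S') = 0`,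
`SphereCoreLocalHomology`, the core `0 × Sˡ` of the handle being the core of the tube
`Sˡ × ℝᵏ⁺¹ ≅ ODᵏ⁺¹ × Sˡ`, `(u, y) ↦ (y/√(1+‖y‖²), u)` — the framed sphere `φ' : Dᵏ⁺¹ × Sˡ ⊂ M'`
of the dual surgery, p. 513): in the middle dimension of an odd manifold this is Kervaire–Milnor's
"`HₖM₀ → HₖM' → 0`" (diagram p. 515).
[cite: KervaireMilnorAnnals1963, Lemma 5.6, proof (p. 515)] [cite: Kosinski1993, Ch. X §1, Prop. 1.1] -/
theorem epi_map_range_jA_val_of_lt [T2Space P] {n : ℕ} (hn : n < k + 1) :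
    Epi (singularHomology.map ℤ ℤ (subsetIncl (range jA)) n) := by
  -- the product chart of the handle
  let e : ((Metric.sphere (0 : EuclideanSpace ℝ (Fin (l + 1))) 1)) × (EuclideanSpace ℝ (Fin (k + 1))) ≃ₜ ↥(ballTimesSphere ι k l) :=
    ((Homeomorph.prodComm _ _).trans
      ((Homeomorph.unitBall (E := EuclideanSpace ℝ (Fin (k + 1)))).prodCongr (Homeomorph.refl ((Metric.sphere (0 : EuclideanSpace ℝ (Fin (l + 1))) 1))))).trans
      (ballTimesSphereHomeomorph ι k l).symm
  have hcore : (jB ∘ e) '' (univ ×ˢ {0}) = jB '' range (coreSlice ι k l) := by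
    rw [image_comp]
    congr 1
    ext b
    simp only [mem_image, mem_prod, mem_univ, true_and, mem_singleton_iff, mem_range]
    constructor
    · rintro ⟨⟨u, y⟩, rfl : y = 0, rfl⟩
      refine ⟨u, Subtype.ext ?_⟩
      show (DiscreteIndex.mk default, ((0 : EuclideanSpace ℝ (Fin (k + 1))), u)) = (DiscreteIndex.mk default,
        (((Homeomorph.unitBall (0 : EuclideanSpace ℝ (Fin (k + 1))) : ball (0 : EuclideanSpace ℝ (Fin (k + 1))) 1) : EuclideanSpace ℝ (Fin (k + 1))), u))
      rw [Homeomorph.coe_unitBall_apply_zero]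
    · rintro ⟨u, rfl⟩
      refine ⟨(u, 0), rfl, Subtype.ext ?_⟩
      show (DiscreteIndex.mk default, (((Homeomorph.unitBall (0 : EuclideanSpace ℝ (Fin (k + 1))) :
        ball (0 : EuclideanSpace ℝ (Fin (k + 1))) 1) : EuclideanSpace ℝ (Fin (k + 1))), u)) = (DiscreteIndex.mk default, ((0 : EuclideanSpace ℝ (Fin (k + 1))), u))
      rw [Homeomorph.coe_unitBall_apply_zero]
  have h := epi_map_subsetIncl_compl_sphereCore ℤ ℤ (hB.comp e.isOpenEmbedding) (i := n)
    (c := k + 1) hn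
  rw [hcore, compl_image_coreSlice_eq_range_jA hcov hrel] at h
  exact h

include hA hB hcov hrel in
/-- **`(jA)_* : Hₙ(X ∖ S) → Hₙ(P)` is onto for `n < k + 1`.**
[cite: KervaireMilnorAnnals1963, Lemma 5.6, proof (p. 515)] -/
theorem epi_map_jA_of_lt [T2Space P] {n : ℕ} (hn : n < k + 1) :
    Epi (singularHomology.map ℤ ℤ (⟨jA, hA.continuous⟩ : C(_, P)) n) :=
  epi_map_of_conj ℤ ℤ (subsetIncl (range jA)) ⟨jA, hA.continuous⟩
    hA.isEmbedding.toHomeomorph.symm (Homeomorph.refl P)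
    (fun x ↦ by
      obtain ⟨x, rfl⟩ := hA.isEmbedding.toHomeomorph.surjective x
      rw [Homeomorph.symm_apply_apply]; rfl) n (epi_map_range_jA_val_of_lt hB hcov hrel hn)

include hrel in
/-- **The new core sphere is homologous in `P` to the meridian**: `jB ∘ (0 × Sˡ)` is homotopic to
`jA ∘ (meridian sphere)` through the spheres `jB(t u₀/2 × Sˡ)` of the handle (Kervaire–Milnor
1963, p. 516: "`ε'` … corresponds to the meridian … `ε' ↦ λ'`").
[cite: KervaireMilnorAnnals1963, Lemma 5.6, proof (p. 516)] -/
theorem map_jB_coreSlice_eq_map_jA_meridian (hBc : Continuous jB) (hAc : Continuous jA)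
    (u₀ : (Metric.sphere (0 : EuclideanSpace ℝ (Fin (k + 1))) 1)) (n : ℕ) :
    singularHomology.map ℤ ℤ ((⟨jB, hBc⟩ : C(_, P)).comp (coreSlice ι k l)) n =
      singularHomology.map ℤ ℤ ((⟨jA, hAc⟩ : C(_, P)).comp (ν.tubeIncl.comp (meridianPT u₀))) n := by
  refine singularHomology.map_eq_of_homotopic ℤ ℤ ⟨?_⟩ n
  exact
    { toFun := fun p => jB ⟨(DiscreteIndex.mk default,
        (((p.1 : ℝ) * 2⁻¹) • (u₀ : EuclideanSpace ℝ (Fin (k + 1))), p.2)), by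
          have h0 : 0 ≤ (p.1 : ℝ) * 2⁻¹ := mul_nonneg p.1.2.1 (by norm_num)
          rw [mem_ballTimesSphere_iff, norm_smul_coe_sphere h0]
          have := p.1.2.2
          linarith⟩
      continuous_toFun := by
        have hc : Continuous fun p : unitInterval × ((Metric.sphere (0 : EuclideanSpace ℝ (Fin (l + 1))) 1)) =>
            (DiscreteIndex.mk (default : ι), (((p.1 : ℝ) * 2⁻¹) • (u₀ : EuclideanSpace ℝ (Fin (k + 1))), p.2)) :=
          continuous_const.prodMk ((((continuous_subtype_val.comp continuous_fst).mul
            continuous_const).smul continuous_const).prodMk continuous_snd)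
        exact hBc.comp (hc.subtype_mk _)
      map_zero_left := fun v => by
        show jB _ = jB _
        congr 1
        apply Subtype.ext
        simp [coreSlice]
      map_one_left := fun v => by
        show jB _ = jA (ν.tubeIncl (meridianPT u₀ v))
        rw [jA_tubeIncl hrel]
        congr 1
        apply Subtype.ext
        show (DiscreteIndex.mk default, (((1 : ℝ) * 2⁻¹) • (u₀ : EuclideanSpace ℝ (Fin (k + 1))), v)) =
          (DiscreteIndex.mk default, (‖(2⁻¹ : ℝ) • (v : EuclideanSpace ℝ (Fin (l + 1)))‖ • (u₀ : EuclideanSpace ℝ (Fin (k + 1))),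
            radialProjection (spherePt l) ((2⁻¹ : ℝ) • (v : EuclideanSpace ℝ (Fin (l + 1))))))
        rw [norm_smul_coe_sphere (by norm_num), radialProjection_smul _ (by norm_num), one_mul] }

end HandleSide

section HandleSideMiddle

variable {EX HX : Type*} [NormedAddCommGroup EX] [NormedSpace ℝ EX] [TopologicalSpace HX]
  {IX : ModelWithCorners ℝ EX HX} {X : Type} [TopologicalSpace X] [ChartedSpace HX X] [T2Space X]
  {ι : Type} [Unique ι] {k : ℕ} {ν : FramedSphereFamily IX X ι k (k + 1)}
  {P : Type} [TopologicalSpace P] {jA : ↥ν.complement → P} {jB : ↥(ballTimesSphere ι k k) → P}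
  (hA : IsOpenEmbedding jA) (hB : IsOpenEmbedding jB) (hcov : range jA ∪ range jB = univ)
  (hrel : ∀ a b, jA a = jB b ↔ sphereFamilySurgeryRel ν a b)

include hA hB hcov hrel in
/-- **`ker ((jA)_* : Hₖ(X ∖ S) → Hₖ(P)) ⊆ ⟨ε, ε'⟩`** (`k ≥ 2`, fibre `ℝᵏ⁺¹`): by exactness of the
Mayer–Vietoris sequence of `P = jA(X ∖ S) ∪ jB(ODᵏ⁺¹ × Sᵏ)` at `Hₖ ⊕ Hₖ`, a class dying in `P`
comes from the intersection, the punctured tube (Kervaire–Milnor 1963, p. 515: the kernel of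
`HₖM₀ → HₖM'` is `ε(Z)`; here only the inclusion in `⟨ε, ε'⟩` is recorded).
[cite: KervaireMilnorAnnals1963, Lemma 5.6, proof (pp. 515–516)] [cite: HatcherAT2002, §2.2 p. 149] -/
theorem mem_closure_pair_of_map_jA_eq_zero (hk : 2 ≤ k) (u₀ : (Metric.sphere (0 : EuclideanSpace ℝ (Fin (k + 1))) 1)) {v₀ : EuclideanSpace ℝ (Fin (k + 1))}
    (hv₀ : v₀ ≠ 0) (hv₁ : ‖v₀‖ < 1) {θ : singularHomology ℤ ℤ ((Metric.sphere (0 : EuclideanSpace ℝ (Fin (k + 1))) 1)) k}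
    (hθ : AddSubgroup.zmultiples θ = ⊤) (g : singularHomology ℤ ℤ ↥ν.complement k)
    (hg : singularHomology.map ℤ ℤ (⟨jA, hA.continuous⟩ : C(_, P)) k g = 0) :
    g ∈ AddSubgroup.closure
      ({singularHomology.map ℤ ℤ (ν.parallelSphere hv₀) k θ,
        singularHomology.map ℤ ℤ (ν.tubeIncl.comp (meridianPT u₀)) k θ} : Set (singularHomology ℤ ℤ ↥ν.complement k)) := by
  set U : Set P := range jA with hU
  set V : Set P := range jB with hV
  have hint : interior U ∪ interior V = univ := by
    rw [hA.isOpen_range.interior_eq, hB.isOpen_range.interior_eq, hcov]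
  -- transport `g` to `Hₖ(range jA)`
  let eA : ↥ν.complement ≃ₜ ↥U := hA.isEmbedding.toHomeomorph
  have heA : (subsetIncl U).comp (eA : C(↥ν.complement, ↥U)) = ⟨jA, hA.continuous⟩ := by
    ext a; rfl
  set g₁ := singularHomology.map ℤ ℤ (eA : C(↥ν.complement, ↥U)) k g with hg₁
  have hg₁0 : singularHomology.map ℤ ℤ (subsetIncl U) k g₁ = 0 := by
    rw [hg₁, ← ModuleCat.comp_apply, ← singularHomology.map_comp, heA, hg]
  -- Mayer–Vietoris: `g₁` comes from the intersection
  have hex := mayerVietoris.exact₁_holds ℤ ℤ U V hint k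
  rw [ShortComplex.moduleCat_exact_iff] at hex
  let HU := singularHomology ℤ ℤ ↥U k
  let HV := singularHomology ℤ ℤ ↥V k
  obtain ⟨zUV, hz⟩ := hex ((biprod.inl : HU ⟶ HU ⊞ HV) g₁) (by
    show (mayerVietoris.ψ ℤ ℤ U V k) ((biprod.inl : HU ⟶ HU ⊞ HV) g₁) = 0
    rw [mayerVietoris.ψ, biprod_desc_inl_apply]
    exact hg₁0)
  have hg' : g₁ = singularHomology.map ℤ ℤ
      (subsetInclusion (inter_subset_left : U ∩ V ⊆ U)) k zUV := by
    have h1 := congrArg (biprod.fst : HU ⊞ HV ⟶ HU) hz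
    change (biprod.fst : HU ⊞ HV ⟶ HU) ((mayerVietoris.φ ℤ ℤ U V k) zUV) =
      (biprod.fst : HU ⊞ HV ⟶ HU) ((biprod.inl : HU ⟶ HU ⊞ HV) g₁) at h1
    rw [mayerVietoris.φ, biprod_fst_lift_apply, ← ModuleCat.comp_apply, biprod.inl_fst,
      ModuleCat.id_apply] at h1
    exact h1.symm
  -- the intersection is the punctured tube, included by `eA ∘ tubeIncl`
  let eT : ↥(puncturedUnitTube k k) ≃ₜ ↥(U ∩ V) := tubeInterHomeomorph hA hrel
  have heT : (subsetInclusion (inter_subset_left : U ∩ V ⊆ U)).comp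
      (eT : C(↥(puncturedUnitTube k k), ↥(U ∩ V))) =
      (eA : C(↥ν.complement, ↥U)).comp ν.tubeIncl := by
    ext q; rfl
  set z := singularHomology.map ℤ ℤ (eT.symm : C(↥(U ∩ V), ↥(puncturedUnitTube k k))) k zUV
    with hzdef
  have hzUV : zUV = singularHomology.map ℤ ℤ (eT : C(↥(puncturedUnitTube k k), ↥(U ∩ V))) k z := by
    rw [hzdef, ← ModuleCat.comp_apply, ← singularHomology.map_comp]
    have : (eT : C(↥(puncturedUnitTube k k), ↥(U ∩ V))).comp
        (eT.symm : C(↥(U ∩ V), ↥(puncturedUnitTube k k))) = ContinuousMap.id _ := by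
      ext1 x; exact eT.apply_symm_apply x
    rw [this, singularHomology.map_id]
    rfl
  have hgz : g = singularHomology.map ℤ ℤ ν.tubeIncl k z := by
    have h2 : g₁ = singularHomology.map ℤ ℤ (eA : C(↥ν.complement, ↥U)) k
        (singularHomology.map ℤ ℤ ν.tubeIncl k z) := by
      rw [hg', hzUV, ← ModuleCat.comp_apply, ← singularHomology.map_comp, heT,
        singularHomology.map_comp, ModuleCat.comp_apply]
    have hinj : Function.Injective (singularHomology.map ℤ ℤ (eA : C(↥ν.complement, ↥U)) k) :=
      (ModuleCat.mono_iff_injective _).1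
        (inferInstance : Mono (singularHomology.mapIso ℤ ℤ eA k).hom)
    exact hinj (hg₁ ▸ h2)
  rw [hgz]
  exact ν.map_tubeIncl_mem_closure_pair hk u₀ hv₀ hv₁ hθ z

end HandleSideMiddle

/-! ### Lemma 5.6 and the Assertion of p. 516 -/

section Lemma56

variable {EX HX : Type*} [NormedAddCommGroup EX] [NormedSpace ℝ EX] [TopologicalSpace HX]
  {IX : ModelWithCorners ℝ EX HX} {X : Type} [TopologicalSpace X] [ChartedSpace HX X] [T2Space X]
  {ι : Type} [Unique ι] {k : ℕ} {ν : FramedSphereFamily IX X ι k (k + 1)}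
  {P : Type} [TopologicalSpace P] [T2Space P]
  {jA : ↥ν.complement → P} {jB : ↥(ballTimesSphere ι k k) → P}
  (hA : IsOpenEmbedding jA) (hB : IsOpenEmbedding jB) (hcov : range jA ∪ range jB = univ)
  (hrel : ∀ a b, jA a = jB b ↔ sphereFamilySurgeryRel ν a b)

include hA hB hcov hrel in
/-- **Kervaire–Milnor's Lemma 5.6** (*Groups of homotopy spheres I*, Ann. of Math. 77 (1963),
pp. 514–516), for Mathlib's singular homology and the tree's surgery gluings. Let `P` be glued
from `X ∖ S` and the handle `ODᵏ⁺¹ × Sᵏ` along a framed `k`-sphere `S = φ(Sᵏ × 0)` with fibre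
`ℝᵏ⁺¹` in a Hausdorff `X` (`k ≥ 2`; the middle dimension of a `(2k+1)`-manifold), `P` Hausdorff;
let `θ` generate `Hₖ(Sᵏ; ℤ)`, `λ = φ(·, 0)_* θ ∈ Hₖ(X)` the class of the sphere and
`λ' = (jB(0, ·))_* θ ∈ Hₖ(P)` the class of the core of the handle ("`λ'` corresponding to
`φ'(0 × Sᵏ)`"). Then *"the quotient group `HₖM/λ(Z)` is isomorphic to `HₖM'/λ'(Z)`"*:
`Hₖ(X; ℤ)/λ(Z) ≃+ Hₖ(P; ℤ)/λ'(Z)`. Proof: with `G = Hₖ(X ∖ S)` and `ε`, `ε'` the classes of the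
parallel and the meridian spheres, `G → Hₖ(X)` is onto, kills `ε'`, maps `ε ↦ λ`, with kernel in
`⟨ε, ε'⟩`, so `Hₖ(X)/λ(Z) ≅ G/⟨ε, ε'⟩`; symmetrically `G → Hₖ(P)` is onto, kills `ε`, maps
`ε' ↦ λ'`, with kernel in `⟨ε, ε'⟩`, so `Hₖ(P)/λ'(Z) ≅ G/⟨ε, ε'⟩`.
[cite: KervaireMilnorAnnals1963, Lemma 5.6 (pp. 514–516)] -/
theorem nonempty_quotient_addEquiv_quotient_of_surgery (hk : 2 ≤ k)
    {θ : singularHomology ℤ ℤ ((Metric.sphere (0 : EuclideanSpace ℝ (Fin (k + 1))) 1)) k} (hθ : AddSubgroup.zmultiples θ = ⊤) :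
    Nonempty (singularHomology ℤ ℤ X k ⧸
        AddSubgroup.zmultiples (singularHomology.map ℤ ℤ ν.sphereMap k θ) ≃+
      singularHomology ℤ ℤ P k ⧸ AddSubgroup.zmultiples
        (singularHomology.map ℤ ℤ ((⟨jB, hB.continuous⟩ : C(_, P)).comp (coreSlice ι k k)) k θ)) := by
  -- the parallel at `v₀ = u₀/2` and the meridian over `u₀`
  let u₀ : (Metric.sphere (0 : EuclideanSpace ℝ (Fin (k + 1))) 1) := spherePt k
  let v₀ : EuclideanSpace ℝ (Fin (k + 1)) := (2⁻¹ : ℝ) • (u₀ : EuclideanSpace ℝ (Fin (k + 1)))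
  have hv₀ : v₀ ≠ 0 := smul_ne_zero (by norm_num) (ne_zero_of_mem_unit_sphere u₀)
  have hv₁ : ‖v₀‖ < 1 := by
    show ‖(2⁻¹ : ℝ) • (u₀ : EuclideanSpace ℝ (Fin (k + 1)))‖ < 1
    rw [norm_smul_coe_sphere (by norm_num)]; norm_num
  set G := singularHomology ℤ ℤ ↥ν.complement k
  set a : G := singularHomology.map ℤ ℤ (ν.parallelSphere hv₀) k θ with ha
  set b : G := singularHomology.map ℤ ℤ (ν.tubeIncl.comp (meridianPT u₀)) k θ with hb
  -- the tube side: `Hₖ(X)/λ ≅ G/⟨ε, ε'⟩`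
  let fX : G →+ singularHomology ℤ ℤ X k :=
    (singularHomology.map ℤ ℤ (subsetIncl (ν.complement : Set X)) k).hom.toAddMonoidHom
  have hfX : Function.Surjective fX :=
    (ModuleCat.epi_iff_surjective _).1 (ν.epi_map_complement_val_of_lt (Nat.lt_succ_self k))
  have hfXb : fX b = 0 := by
    show singularHomology.map ℤ ℤ (subsetIncl (ν.complement : Set X)) k
      (singularHomology.map ℤ ℤ (ν.tubeIncl.comp (meridianPT u₀)) k θ) = 0
    rw [← ModuleCat.comp_apply, ← singularHomology.map_comp,
      ν.map_val_tubeIncl_meridianPT_eq_zero u₀ (by omega)]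
    rfl
  have hfXa : fX a = singularHomology.map ℤ ℤ ν.sphereMap k θ := by
    show singularHomology.map ℤ ℤ (subsetIncl (ν.complement : Set X)) k
      (singularHomology.map ℤ ℤ (ν.parallelSphere hv₀) k θ) = _
    rw [← ModuleCat.comp_apply, ← singularHomology.map_comp,
      map_parallelSphere_eq_map_sphere ℤ ℤ hv₀ k]
  have hkerX : ∀ g, fX g = 0 → g ∈ AddSubgroup.closure ({a, b} : Set G) := fun g hg =>
    ν.mem_closure_pair_of_map_complement_val_eq_zero hk u₀ hv₀ hv₁ hθ g hg
  have hX := nonempty_addEquiv_quotientPair fX hfX a b hfXb hkerX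
  rw [hfXa] at hX
  obtain ⟨eX⟩ := hX
  -- the handle side: `Hₖ(P)/λ' ≅ G/⟨ε', ε⟩`
  let fP : G →+ singularHomology ℤ ℤ P k :=
    (singularHomology.map ℤ ℤ (⟨jA, hA.continuous⟩ : C(_, P)) k).hom.toAddMonoidHom
  have hfP : Function.Surjective fP :=
    (ModuleCat.epi_iff_surjective _).1 (epi_map_jA_of_lt hA hB hcov hrel (Nat.lt_succ_self k))
  have hfPa : fP a = 0 := by
    show singularHomology.map ℤ ℤ (⟨jA, hA.continuous⟩ : C(_, P)) k
      (singularHomology.map ℤ ℤ (ν.parallelSphere hv₀) k θ) = 0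
    rw [← ModuleCat.comp_apply, ← singularHomology.map_comp,
      map_jA_parallelSphere_eq_zero ℤ ℤ hrel hB.continuous hA.continuous hv₀ hv₁ (by omega)]
    rfl
  have hfPb : fP b = singularHomology.map ℤ ℤ
      ((⟨jB, hB.continuous⟩ : C(_, P)).comp (coreSlice ι k k)) k θ := by
    show singularHomology.map ℤ ℤ (⟨jA, hA.continuous⟩ : C(_, P)) k
      (singularHomology.map ℤ ℤ (ν.tubeIncl.comp (meridianPT u₀)) k θ) = _
    rw [← ModuleCat.comp_apply, ← singularHomology.map_comp,
      map_jB_coreSlice_eq_map_jA_meridian hrel hB.continuous hA.continuous u₀ k]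
  have hkerP : ∀ g, fP g = 0 → g ∈ AddSubgroup.closure ({b, a} : Set G) := fun g hg => by
    rw [Set.pair_comm]
    exact mem_closure_pair_of_map_jA_eq_zero hA hB hcov hrel hk u₀ hv₀ hv₁ hθ g hg
  have hP := nonempty_addEquiv_quotientPair fP hfP b a hfPa hkerP
  rw [hfPb] at hP
  obtain ⟨eP⟩ := hP
  have hpair : AddSubgroup.closure ({a, b} : Set G) = AddSubgroup.closure ({b, a} : Set G) := by
    rw [Set.pair_comm]
  exact ⟨(eX.symm.trans (QuotientAddGroup.quotientAddEquivOfEq hpair)).trans eP⟩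

include hA hB hcov hrel in
/-- **Kervaire–Milnor's Assertion (p. 516), homological form: a primitive class can be killed.**
In the situation of Lemma 5.6 (`nonempty_quotient_addEquiv_quotient_of_surgery`), suppose moreover
that `Hₖ₊₁(X; ℤ) → Hₖ₊₁(X, X ∖ S; ℤ)` is onto — the homological content of "`λ` is primitive in
the sense that `μ·λ = 1` for some `μ ∈ Hₖ₊₁M`", the map `Hₖ₊₁M → Hₖ₊₁(M, M₀) ≅ Z` being
`μ ↦ μ·λ` (diagram p. 515; the same hypothesis `hprim` as in
`isZero_singularHomology_of_middleSurgery_of_epi`). Then `Hₖ(X ∖ S) → Hₖ(X)` is injective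
(exact sequence of the pair), the meridian class `ε'` vanishes already in `Hₖ(X ∖ S)` ("the
boundary `∂μ'` is homologous to `x₀ × Sᵏ`", p. 516), and the surgery kills exactly `λ`:
*"The sphere `β(Sᵏ)` represents the homology class `λ' ∈ HₖM'` … is homologous to zero"*,
`Hₖ(P; ℤ) ≃+ Hₖ(X; ℤ)/λ(Z)` — "This completes the proof of Lemma 5.6 / the Assertion".
[cite: KervaireMilnorAnnals1963, Assertion p. 516 with Lemma 5.6 (pp. 514–516)] -/
theorem nonempty_addEquiv_quotient_of_surgery_of_epi (hk : 2 ≤ k)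
    {θ : singularHomology ℤ ℤ ((Metric.sphere (0 : EuclideanSpace ℝ (Fin (k + 1))) 1)) k} (hθ : AddSubgroup.zmultiples θ = ⊤)
    (hprim : Epi (relativeSingularHomology.ofAbsolute ℤ ℤ X (ν.complement : Set X) (k + 1))) :
    Nonempty (singularHomology ℤ ℤ P k ≃+ singularHomology ℤ ℤ X k ⧸
      AddSubgroup.zmultiples (singularHomology.map ℤ ℤ ν.sphereMap k θ)) := by
  let u₀ : (Metric.sphere (0 : EuclideanSpace ℝ (Fin (k + 1))) 1) := spherePt k
  let v₀ : EuclideanSpace ℝ (Fin (k + 1)) := (2⁻¹ : ℝ) • (u₀ : EuclideanSpace ℝ (Fin (k + 1)))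
  have hv₀ : v₀ ≠ 0 := smul_ne_zero (by norm_num) (ne_zero_of_mem_unit_sphere u₀)
  have hv₁ : ‖v₀‖ < 1 := by
    show ‖(2⁻¹ : ℝ) • (u₀ : EuclideanSpace ℝ (Fin (k + 1)))‖ < 1
    rw [norm_smul_coe_sphere (by norm_num)]; norm_num
  set G := singularHomology ℤ ℤ ↥ν.complement k
  set a : G := singularHomology.map ℤ ℤ (ν.parallelSphere hv₀) k θ with ha
  set b : G := singularHomology.map ℤ ℤ (ν.tubeIncl.comp (meridianPT u₀)) k θ with hb
  -- the tube side: `G ≅ Hₖ(X)`, `ε ↦ λ`, and `ε' = 0`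
  let fX : G →+ singularHomology ℤ ℤ X k :=
    (singularHomology.map ℤ ℤ (subsetIncl (ν.complement : Set X)) k).hom.toAddMonoidHom
  have hfX : Function.Surjective fX :=
    (ModuleCat.epi_iff_surjective _).1 (ν.epi_map_complement_val_of_lt (Nat.lt_succ_self k))
  have hδ : relativeSingularHomology.δ ℤ ℤ X (ν.complement : Set X) k = 0 := by
    rw [← cancel_epi (relativeSingularHomology.ofAbsolute ℤ ℤ X (ν.complement : Set X) (k + 1)),
      relativeSingularHomology.ofAbsolute_comp_δ, comp_zero]
  have hfXi : Function.Injective fX :=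
    (ModuleCat.mono_iff_injective _).1
      ((relativeSingularHomology.exact_δ_map ℤ ℤ (ν.complement : Set X) k).mono_g hδ)
  have hfXb : fX b = 0 := by
    show singularHomology.map ℤ ℤ (subsetIncl (ν.complement : Set X)) k
      (singularHomology.map ℤ ℤ (ν.tubeIncl.comp (meridianPT u₀)) k θ) = 0
    rw [← ModuleCat.comp_apply, ← singularHomology.map_comp,
      ν.map_val_tubeIncl_meridianPT_eq_zero u₀ (by omega)]
    rfl
  have hb0 : b = 0 := hfXi (by rw [hfXb, map_zero])
  have hfXa : fX a = singularHomology.map ℤ ℤ ν.sphereMap k θ := by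
    show singularHomology.map ℤ ℤ (subsetIncl (ν.complement : Set X)) k
      (singularHomology.map ℤ ℤ (ν.parallelSphere hv₀) k θ) = _
    rw [← ModuleCat.comp_apply, ← singularHomology.map_comp,
      map_parallelSphere_eq_map_sphere ℤ ℤ hv₀ k]
  -- the handle side: `Hₖ(P) ≅ G/⟨ε⟩`
  let fP : G →+ singularHomology ℤ ℤ P k :=
    (singularHomology.map ℤ ℤ (⟨jA, hA.continuous⟩ : C(_, P)) k).hom.toAddMonoidHom
  have hfP : Function.Surjective fP :=
    (ModuleCat.epi_iff_surjective _).1 (epi_map_jA_of_lt hA hB hcov hrel (Nat.lt_succ_self k))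
  have hfPa : fP a = 0 := by
    show singularHomology.map ℤ ℤ (⟨jA, hA.continuous⟩ : C(_, P)) k
      (singularHomology.map ℤ ℤ (ν.parallelSphere hv₀) k θ) = 0
    rw [← ModuleCat.comp_apply, ← singularHomology.map_comp,
      map_jA_parallelSphere_eq_zero ℤ ℤ hrel hB.continuous hA.continuous hv₀ hv₁ (by omega)]
    rfl
  have hkerP : ∀ g, fP g = 0 → g ∈ AddSubgroup.zmultiples a := fun g hg => by
    have h := mem_closure_pair_of_map_jA_eq_zero hA hB hcov hrel hk u₀ hv₀ hv₁ hθ g hg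
    rw [← hb, hb0] at h
    refine (AddSubgroup.closure_le _).2 ?_ h
    intro x hx
    rcases hx with hx | hx
    · rw [hx]; exact AddSubgroup.mem_zmultiples a
    · rw [mem_singleton_iff.1 hx]; exact zero_mem _
  have hP := nonempty_addEquiv_quotient_of_ker_eq fP hfP a hfPa hkerP fX ⟨hfXi, hfX⟩
  rw [hfXa] at hP
  exact hP

end Lemma56

/-! ### Specialisation to the tree's surgered manifold `χ(X, φ) = ν.Surgered hkl` -/

section Surgered

variable {n k : ℕ} {X : Type} [TopologicalSpace X] [ChartedSpace (EuclideanHalfSpace (n + 1)) X]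
  [T2Space X] [IsManifold (𝓡∂ (n + 1)) ∞ X] {ι : Type} [Unique ι]
  (ν : FramedSphereFamily (𝓡∂ (n + 1)) X ι k (k + 1)) (hkl : k + k = n)

/-- **Lemma 5.6 for `χ(X, φ) = ν.Surgered hkl`**: `Hₖ(X)/λ(Z) ≃+ Hₖ(χ(X, φ))/λ'(Z)` for a framed
`k`-sphere with fibre `ℝᵏ⁺¹` in a `(2k+1)`-manifold with boundary, `k ≥ 2`, `λ'` the class of
the core sphere `φ'(0 × Sᵏ) = inr (toHandle (0, ·))` of the handle of `χ(X, φ)`.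
[cite: KervaireMilnorAnnals1963, Lemma 5.6 (pp. 514–516)] -/
theorem nonempty_quotient_addEquiv_quotient_surgered (hk : 2 ≤ k)
    {θ : singularHomology ℤ ℤ ((Metric.sphere (0 : EuclideanSpace ℝ (Fin (k + 1))) 1)) k} (hθ : AddSubgroup.zmultiples θ = ⊤) :
    Nonempty (singularHomology ℤ ℤ X k ⧸
        AddSubgroup.zmultiples (singularHomology.map ℤ ℤ ν.sphereMap k θ) ≃+
      singularHomology ℤ ℤ (ν.Surgered hkl) k ⧸ AddSubgroup.zmultiples
        (singularHomology.map ℤ ℤ ((⟨(ν.glueData hkl).inr ∘ SphereSurgery.toHandle ι k k hkl,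
          (ν.surgered_gluing hkl).2.1.continuous⟩ :
            C(↥(ballTimesSphere ι k k), ν.Surgered hkl)).comp (coreSlice ι k k)) k θ)) := by
  obtain ⟨hA, hB, hcov, hrel⟩ := ν.surgered_gluing hkl
  exact nonempty_quotient_addEquiv_quotient_of_surgery hA hB hcov hrel hk hθ

/-- **The Assertion of p. 516 for `χ(X, φ) = ν.Surgered hkl`**: if `Hₖ₊₁(X) → Hₖ₊₁(X, X ∖ S)` is
onto (primitivity of `λ`), then `Hₖ(χ(X, φ)) ≃+ Hₖ(X)/λ(Z)`.
[cite: KervaireMilnorAnnals1963, Assertion p. 516] -/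
theorem nonempty_addEquiv_quotient_surgered_of_epi (hk : 2 ≤ k)
    {θ : singularHomology ℤ ℤ ((Metric.sphere (0 : EuclideanSpace ℝ (Fin (k + 1))) 1)) k} (hθ : AddSubgroup.zmultiples θ = ⊤)
    (hprim : Epi (relativeSingularHomology.ofAbsolute ℤ ℤ X (ν.complement : Set X) (k + 1))) :
    Nonempty (singularHomology ℤ ℤ (ν.Surgered hkl) k ≃+ singularHomology ℤ ℤ X k ⧸
      AddSubgroup.zmultiples (singularHomology.map ℤ ℤ ν.sphereMap k θ)) := by
  obtain ⟨hA, hB, hcov, hrel⟩ := ν.surgered_gluing hkl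
  exact nonempty_addEquiv_quotient_of_surgery_of_epi hA hB hcov hrel hk hθ hprim

end Surgered




end FramedSphereFamily

end Literature.Topology.FourManifolds

end
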